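import Mathlib
import Summits.KontsevichZagierPeriods.KontsevichZagierPeriods.Theorems.InverseLandauTateFamilyKernelStubHermiteReduce
import Summits.KontsevichZagierPeriods.KontsevichZagierPeriods.Theorems.InverseLandauTateFamilyKernelStubTateFaceCoprime

/-!
# Crux `TateFamilyKernel` (stmt-KontsevichZagierPeriods-9130), line `Sketch` — `stub_hermiteFaceMv`
# (wave 15, pure algebra: Hermite reduction of one face, in `MvPolynomial` form with cleared
# denominators)

Variables of `MvPolynomial (Fin 2) ℚ`: `X 0 = s`, `X 1 = ϖ`; the face denominator is
`D = 1 − ϖ·τ(s)` for a non-constant `τ ∈ ℚ[s]`. For every `k : ℕ` and `N ∈ ℚ[s, ϖ]` we produce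
`c ∈ ℚ[ϖ] ∖ 0` and `M, R ∈ ℚ[s, ϖ]` with `deg_s R < deg τ` and

  `c(ϖ)·N = ∂_s M · D − k·M·∂_s D + R·D^k`.

Proof.
* `φ = aeval ![X, C X] : ℚ[s, ϖ] →ₐ ℚ[ϖ][s]` is an isomorphism with inverse
  `ψ = aevalTower (aeval (X 1)) (X 0)` (two extensionality computations); it turns `pderiv 0`
  into `Polynomial.derivative` and `ψ` turns `natDegree` bounds into `degreeOf 0` bounds.
* `ι = map (algebraMap ℚ[ϖ] ℚ(ϖ)) : ℚ[ϖ][s] ↪ ℚ(ϖ)[s]` (`ℚ(ϖ) = RatFunc ℚ`) is injective and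
  `ι (φ D) = 1 − C RatFunc.X · τ`, which is coprime to its `s`-derivative
  (`stub_tateFaceCoprime`) and of degree `deg τ > 0`; Hermite reduction over the field `ℚ(ϖ)`
  (`stub_hermiteReduce`) gives `ι (φ N) = M₁'·D − k·M₁·D' + R₁·D^k` with `deg R₁ < deg τ`.
* `IsLocalization.integerNormalization` clears the denominators of `M₁` (factor `b₁`) and of
  `R₁` (factor `b₂`); with `c = b₁ b₂`, `M = ψ (C b₂ · M₀)`, `R = ψ (C b₁ · R₀)` the identity
  multiplied by `C (b₁ b₂)` is the `ι ∘ φ`-image of the claimed one, and `ι ∘ φ` is injective.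

Mathlib only (plus the two landed stubs); no named fact, no new definition. Helpers live in the
sub-namespace `HermiteFaceMv`. [folklore: Hermite reduction]
-/

noncomputable section

open MeasureTheory Set MvPolynomial

namespace Summit.KontsevichZagierPeriods.InverseLandau.TateFamilyKernel.Descent

namespace HermiteFaceMv

/-- `Polynomial.derivative ∘ aeval v = aeval v ∘ pderiv 0` as soon as `(v 0)' = 1` and
`(v 1)' = 0` (both sides are derivations agreeing on the generators). -/
theorem derivative_aeval {S : Type*} [CommRing S] [Algebra ℚ S] (v : Fin 2 → Polynomial S)
    (h0 : Polynomial.derivative (v 0) = 1) (h1 : Polynomial.derivative (v 1) = 0)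
    (p : MvPolynomial (Fin 2) ℚ) :
    Polynomial.derivative (aeval v p) = aeval v (pderiv 0 p) := by
  induction p using MvPolynomial.induction_on with
  | C a =>
      simp only [aeval_C, Polynomial.algebraMap_apply, Polynomial.derivative_C, pderiv_C, map_zero]
  | add p q hp hq => simp only [map_add, hp, hq]
  | mul_X p i hp =>
      rw [map_mul, Polynomial.derivative_mul, hp, pderiv_mul, map_add, map_mul, map_mul, aeval_X]
      congr 1
      fin_cases i
      · simp [h0]
      · simp [h1]

/-- `ψ ∘ φ = id` on `ℚ[s, ϖ]`, where `φ = aeval ![X, C X]` and `ψ = aevalTower (aeval (X 1)) (X 0)`. -/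
theorem aevalTower_aeval (p : MvPolynomial (Fin 2) ℚ) :
    Polynomial.aevalTower (Polynomial.aeval (X 1) : Polynomial ℚ →ₐ[ℚ] MvPolynomial (Fin 2) ℚ) (X 0)
      ((aeval ![Polynomial.X, Polynomial.C Polynomial.X] :
        MvPolynomial (Fin 2) ℚ →ₐ[ℚ] Polynomial (Polynomial ℚ)) p) = p := by
  set ψ := Polynomial.aevalTower
    (Polynomial.aeval (X 1) : Polynomial ℚ →ₐ[ℚ] MvPolynomial (Fin 2) ℚ) (X 0) with hψ
  set φ : MvPolynomial (Fin 2) ℚ →ₐ[ℚ] Polynomial (Polynomial ℚ) :=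
    aeval ![Polynomial.X, Polynomial.C Polynomial.X] with hφ
  have h : ψ.comp φ = AlgHom.id ℚ _ := by
    refine MvPolynomial.algHom_ext fun i => ?_
    fin_cases i
    · simp [hψ, hφ]
    · simp [hψ, hφ]
  exact AlgHom.congr_fun h p

/-- `φ ∘ ψ = id` on `ℚ[ϖ][s]`, where `φ = aeval ![X, C X]` and `ψ = aevalTower (aeval (X 1)) (X 0)`. -/
theorem aeval_aevalTower (P : Polynomial (Polynomial ℚ)) :
    (aeval ![Polynomial.X, Polynomial.C Polynomial.X] :
        MvPolynomial (Fin 2) ℚ →ₐ[ℚ] Polynomial (Polynomial ℚ))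
      (Polynomial.aevalTower
        (Polynomial.aeval (X 1) : Polynomial ℚ →ₐ[ℚ] MvPolynomial (Fin 2) ℚ) (X 0) P) = P := by
  set ψ := Polynomial.aevalTower
    (Polynomial.aeval (X 1) : Polynomial ℚ →ₐ[ℚ] MvPolynomial (Fin 2) ℚ) (X 0) with hψ
  set φ : MvPolynomial (Fin 2) ℚ →ₐ[ℚ] Polynomial (Polynomial ℚ) :=
    aeval ![Polynomial.X, Polynomial.C Polynomial.X] with hφ
  have h : φ.comp ψ = AlgHom.id ℚ _ := by
    refine Polynomial.algHom_ext' (Polynomial.algHom_ext ?_) ?_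
    · simp [hψ, hφ, Polynomial.CAlgHom]
    · simp [hψ, hφ]
  exact AlgHom.congr_fun h P

/-- A polynomial in `ϖ = X 1` alone has `s`-degree `degreeOf 0` equal to `0`. -/
theorem degreeOf_aeval_X_one (a : Polynomial ℚ) :
    degreeOf 0 (Polynomial.aeval (X 1 : MvPolynomial (Fin 2) ℚ) a) = 0 := by
  rw [Polynomial.aeval_eq_sum_range]
  refine Nat.eq_zero_of_le_zero ((degreeOf_sum_le _ _ _).trans (Finset.sup_le fun i _ => ?_))
  rw [MvPolynomial.smul_eq_C_mul]
  refine (degreeOf_C_mul_le _ _ _).trans ((degreeOf_pow_le _ _ _).trans ?_)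
  rw [degreeOf_X, if_neg (by decide), mul_zero]

/-- `ψ = aevalTower (aeval (X 1)) (X 0)` turns the `s`-degree `natDegree` of `ℚ[ϖ][s]` into a
bound for `degreeOf 0`. -/
theorem degreeOf_aevalTower_le (P : Polynomial (Polynomial ℚ)) :
    degreeOf 0 (Polynomial.aevalTower
        (Polynomial.aeval (X 1) : Polynomial ℚ →ₐ[ℚ] MvPolynomial (Fin 2) ℚ) (X 0) P)
      ≤ P.natDegree := by
  conv_lhs => rw [P.as_sum_range_C_mul_X_pow]
  rw [map_sum]
  refine (degreeOf_sum_le _ _ _).trans (Finset.sup_le fun i hi => ?_)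
  rw [map_mul, map_pow, Polynomial.aevalTower_C, Polynomial.aevalTower_X]
  refine (degreeOf_mul_le _ _ _).trans ?_
  rw [degreeOf_aeval_X_one, zero_add]
  refine (degreeOf_pow_le _ _ _).trans ?_
  rw [degreeOf_X, if_pos rfl, mul_one]
  exact Nat.lt_succ_iff.mp (Finset.mem_range.mp hi)

/-- The face denominator `1 − ϖ·τ(s) ∈ ℚ(ϖ)[s]` has `s`-degree `deg τ` (for `τ` non-constant). -/
theorem natDegree_face (τ : Polynomial ℚ) (hτ : 0 < τ.natDegree) :
    (1 - Polynomial.C (RatFunc.X : RatFunc ℚ) * τ.map (algebraMap ℚ (RatFunc ℚ))).natDegree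
      = τ.natDegree := by
  have h : (Polynomial.C (RatFunc.X : RatFunc ℚ) * τ.map (algebraMap ℚ (RatFunc ℚ))).natDegree
      = τ.natDegree := by
    rw [Polynomial.natDegree_C_mul RatFunc.X_ne_zero, Polynomial.natDegree_map]
  rw [Polynomial.natDegree_sub_eq_right_of_natDegree_lt (by rwa [h, Polynomial.natDegree_one]), h]

/-- `ι (φ D) = 1 − C RatFunc.X · τ`: the image of the face denominator `D = 1 − X 1 · τ(X 0)` in
`ℚ(ϖ)[s]` is the polynomial of `stub_tateFaceCoprime`. -/
theorem map_aeval_face (τ : Polynomial ℚ) :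
    ((aeval ![Polynomial.X, Polynomial.C Polynomial.X] :
        MvPolynomial (Fin 2) ℚ →ₐ[ℚ] Polynomial (Polynomial ℚ))
        (1 - X 1 * Polynomial.aeval (X 0 : MvPolynomial (Fin 2) ℚ) τ)).map
      (algebraMap (Polynomial ℚ) (RatFunc ℚ))
      = 1 - Polynomial.C (RatFunc.X : RatFunc ℚ) * τ.map (algebraMap ℚ (RatFunc ℚ)) := by
  rw [map_sub, map_one, map_mul, aeval_X, ← Polynomial.aeval_algHom_apply, aeval_X]
  simp only [Matrix.cons_val_one, Matrix.cons_val_zero]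
  rw [Polynomial.aeval_X_left_eq_map, Polynomial.map_sub, Polynomial.map_one, Polynomial.map_mul,
    Polynomial.map_C, RatFunc.algebraMap_X, Polynomial.map_map]
  congr
  exact Subsingleton.elim _ _

/-- `ι (φ (c(ϖ))) = C c`: a polynomial in `ϖ = X 1` alone becomes the constant `c ∈ ℚ[ϖ] ⊆ ℚ(ϖ)`
of `ℚ(ϖ)[s]`. -/
theorem map_aeval_aevalTower (c : Polynomial ℚ) :
    ((aeval ![Polynomial.X, Polynomial.C Polynomial.X] :
        MvPolynomial (Fin 2) ℚ →ₐ[ℚ] Polynomial (Polynomial ℚ))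
        (Polynomial.aeval (X 1 : MvPolynomial (Fin 2) ℚ) c)).map
      (algebraMap (Polynomial ℚ) (RatFunc ℚ))
      = Polynomial.C (algebraMap (Polynomial ℚ) (RatFunc ℚ) c) := by
  rw [← Polynomial.aevalTower_C (Polynomial.aeval (X 1) : Polynomial ℚ →ₐ[ℚ] MvPolynomial (Fin 2) ℚ)
    (X 0) c, aeval_aevalTower, Polynomial.map_C]

end HermiteFaceMv

/-- **Hermite reduction of one face, in polynomial form with cleared denominators.**
For `τ ∈ ℚ[s]` non-constant, `k : ℕ` and `N ∈ ℚ[s,ϖ]` there are `c ∈ ℚ[ϖ] ∖ 0` and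
`M, R ∈ ℚ[s,ϖ]` with `deg_s R < deg τ` and `c·N = ∂_sM·D − k·M·∂_sD + R·D^k`, `D = 1 − ϖτ(s)` —
i.e. `cN/D^{k+1} = ∂_s(M/D^k) + R/D`. Proof: identify `ℚ[s,ϖ] ≅ ℚ[ϖ][s] ↪ ℚ(ϖ)[s]`
(`aeval`/`aevalTower`, `Polynomial.map` of the injective `algebraMap ℚ[ϖ] (RatFunc ℚ)`), apply
`stub_hermiteReduce` over the field `ℚ(ϖ)`, where `D` is coprime to `∂_sD` by
`stub_tateFaceCoprime`, clear the finitely many denominators with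
`IsLocalization.integerNormalization`, and pull the identity back along the injection.
Variables `X 0 = s`, `X 1 = ϖ`. [folklore: Hermite reduction] -/
theorem stub_hermiteFaceMv (τ : Polynomial ℚ) (hτ : 0 < τ.natDegree) (k : ℕ) (N : MvPolynomial (Fin 2) ℚ) :
    ∃ (c : Polynomial ℚ) (M R : MvPolynomial (Fin 2) ℚ), c ≠ 0 ∧ R.degreeOf 0 < τ.natDegree ∧
      Polynomial.aeval (X 1 : MvPolynomial (Fin 2) ℚ) c * N =
        pderiv 0 M * (1 - X 1 * Polynomial.aeval (X 0 : MvPolynomial (Fin 2) ℚ) τ) -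
          C (k : ℚ) * (M * pderiv 0 (1 - X 1 * Polynomial.aeval (X 0 : MvPolynomial (Fin 2) ℚ) τ)) +
          R * (1 - X 1 * Polynomial.aeval (X 0 : MvPolynomial (Fin 2) ℚ) τ) ^ k := by
  -- `φ : ℚ[s, ϖ] ≅ ℚ[ϖ][s]` (inverse `ψ`) and the coefficient extension `ι : ℚ[ϖ][s] ↪ ℚ(ϖ)[s]`
  set φ : MvPolynomial (Fin 2) ℚ →ₐ[ℚ] Polynomial (Polynomial ℚ) :=
    aeval ![Polynomial.X, Polynomial.C Polynomial.X] with hφ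
  set ψ : Polynomial (Polynomial ℚ) →ₐ[ℚ] MvPolynomial (Fin 2) ℚ := Polynomial.aevalTower
    (Polynomial.aeval (X 1) : Polynomial ℚ →ₐ[ℚ] MvPolynomial (Fin 2) ℚ) (X 0) with hψ
  set ι : Polynomial (Polynomial ℚ) →+* Polynomial (RatFunc ℚ) :=
    Polynomial.mapRingHom (algebraMap (Polynomial ℚ) (RatFunc ℚ)) with hι
  set D : MvPolynomial (Fin 2) ℚ := 1 - X 1 * Polynomial.aeval (X 0 : MvPolynomial (Fin 2) ℚ) τ
    with hD
  set DK : Polynomial (RatFunc ℚ) :=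
    1 - Polynomial.C (RatFunc.X : RatFunc ℚ) * τ.map (algebraMap ℚ (RatFunc ℚ)) with hDK
  have hιinj : Function.Injective ι :=
    Polynomial.map_injective _ (IsFractionRing.injective (Polynomial ℚ) (RatFunc ℚ))
  have hφψ : ∀ P, φ (ψ P) = P := HermiteFaceMv.aeval_aevalTower
  have hψφ : ∀ p, ψ (φ p) = p := HermiteFaceMv.aevalTower_aeval
  have hφinj : Function.Injective φ := Function.LeftInverse.injective hψφ
  have hιφD : ι (φ D) = DK := HermiteFaceMv.map_aeval_face τ
  have hderiv : ∀ p, φ (pderiv 0 p) = Polynomial.derivative (φ p) := fun p =>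
    (HermiteFaceMv.derivative_aeval _ (by simp) (by simp) p).symm
  have hderivι : ∀ P, ι (Polynomial.derivative P) = Polynomial.derivative (ι P) := fun P =>
    (Polynomial.derivative_map P _).symm
  have hψC : ∀ b, ψ (Polynomial.C b) = Polynomial.aeval (X 1 : MvPolynomial (Fin 2) ℚ) b :=
    fun b => Polynomial.aevalTower_C _ _ b
  have hcoef : ∀ b, ι (φ (Polynomial.aeval (X 1 : MvPolynomial (Fin 2) ℚ) b))
      = Polynomial.C (algebraMap (Polynomial ℚ) (RatFunc ℚ) b) :=
    HermiteFaceMv.map_aeval_aevalTower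
  have hk : ι (φ (C (k : ℚ))) = Polynomial.C ((k : ℕ) : RatFunc ℚ) := by
    simp only [map_natCast]
  have hsmul : ∀ (b : Polynomial ℚ) (P : Polynomial (RatFunc ℚ)),
      b • P = Polynomial.C (algebraMap (Polynomial ℚ) (RatFunc ℚ) b) * P := fun b P => by
    rw [Algebra.smul_def, Polynomial.algebraMap_apply]
  have hdeg : DK.natDegree = τ.natDegree := HermiteFaceMv.natDegree_face τ hτ
  -- Hermite reduction over the field `ℚ(ϖ)` (`stub_hermiteReduce`, `stub_tateFaceCoprime`)
  obtain ⟨M₁, R₁, hR₁, hid⟩ :=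
    stub_hermiteReduce DK (stub_tateFaceCoprime τ hτ) (by rw [hdeg]; exact hτ) k (ι (φ N))
  -- common denominators `b₁` of the coefficients of `M₁` and `b₂` of those of `R₁`
  obtain ⟨b₁, hb₁, hM₁⟩ :=
    IsLocalization.integerNormalization_spec (nonZeroDivisors (Polynomial ℚ)) M₁
  obtain ⟨b₂, hb₂, hR₁'⟩ :=
    IsLocalization.integerNormalization_spec (nonZeroDivisors (Polynomial ℚ)) R₁
  set M₀ : Polynomial (Polynomial ℚ) :=
    IsLocalization.integerNormalization (nonZeroDivisors (Polynomial ℚ)) M₁ with hM₀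
  set R₀ : Polynomial (Polynomial ℚ) :=
    IsLocalization.integerNormalization (nonZeroDivisors (Polynomial ℚ)) R₁ with hR₀
  have hιM₀ : ι M₀ = Polynomial.C (algebraMap (Polynomial ℚ) (RatFunc ℚ) b₁) * M₁ := by
    rw [← hsmul, ← hM₁]; rfl
  have hιR₀ : ι R₀ = Polynomial.C (algebraMap (Polynomial ℚ) (RatFunc ℚ) b₂) * R₁ := by
    rw [← hsmul, ← hR₁']; rfl
  refine ⟨b₁ * b₂, ψ (Polynomial.C b₂ * M₀), ψ (Polynomial.C b₁ * R₀),
    mul_ne_zero (nonZeroDivisors.ne_zero hb₁) (nonZeroDivisors.ne_zero hb₂), ?_, ?_⟩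
  · -- the `s`-degree of the remainder `R = ψ (C b₁ · R₀)`
    calc degreeOf 0 (ψ (Polynomial.C b₁ * R₀))
        ≤ (Polynomial.C b₁ * R₀).natDegree := HermiteFaceMv.degreeOf_aevalTower_le _
      _ ≤ R₀.natDegree := Polynomial.natDegree_C_mul_le _ _
      _ = (ι R₀).natDegree := (Polynomial.natDegree_map_eq_of_injective
          (IsFractionRing.injective (Polynomial ℚ) (RatFunc ℚ)) _).symm
      _ = R₁.natDegree := by
          rw [hιR₀, Polynomial.natDegree_C_mul]
          exact IsFractionRing.to_map_ne_zero_of_mem_nonZeroDivisors hb₂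
      _ < τ.natDegree := hdeg ▸ hR₁
  · -- the identity, checked in `ℚ(ϖ)[s]` after applying the injection `ι ∘ φ`
    apply hφinj
    apply hιinj
    simp only [map_mul, map_add, map_sub, map_pow, hderiv, hderivι, hφψ, hψC, hcoef, hιM₀, hιR₀,
      hιφD, hk, Polynomial.derivative_C_mul]
    linear_combination (Polynomial.C (algebraMap (Polynomial ℚ) (RatFunc ℚ) b₁)
      * Polynomial.C (algebraMap (Polynomial ℚ) (RatFunc ℚ) b₂)) * hid

end Summit.KontsevichZagierPeriods.InverseLandau.TateFamilyKernel.Descent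

end
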